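import Literature.AnabelianGeometry.EtaleTheta.Discharge.Sec3Cor38iiiFSMWeak
import Literature.AnabelianGeometry.EtaleTheta.Discharge.Sec3Cor38StdIsoNotGLUnconditional
import Literature.AnabelianGeometry.EtaleTheta.Discharge.Sec3Thm37StandardWeak
import Literature.AlgebraicGeometry.Frobenioids.Thm42PrimaryStepsGeneralWeak
import HarnessLib

/-!
# [EtTh] Corollary 3.8 (iii), first clause, over the WEAK monoid vocabulary — the [FrdI] Thm. 4.2 (i) and
# Thm. 3.4 (iii) inputs DISCHARGED from C38-L02a (pre-step preservation)

Mochizuki, *The étale theta function …*, Publ. RIMS **45** (2009), Cor. 3.8 (iii), PDF p.81, proof p.82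
[cite: MochizukiEtTh2009, Cor 3.8 p.81]: "by Theorem 3.7, (i), (ii), `C₁`, `C₂` are of standard and isotropic type,
but not of group-like type. In particular, by [Mzk17], Theorem 3.4, (ii); [Mzk17], Theorem 4.2, (i), it follows that
`Ψ` preserves pre-steps and primary steps."  [Mzk17] = Mochizuki, *The geometry of Frobenioids I*, Kyushu J. Math.
**62** (2008), Thm. 3.4 (ii)(iii) pp.62–63, Thm. 4.2 (i) p.77 [cite: MochizukiFrdI2008, Thm. 4.2 (i) p.77].

**WEAK-VOCABULARY TWIN** (abc-iut cell, layer L2, node `EtTh:Cor3.8(iii)`, seat abc-iut-L2-d2 gen 4; findings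
F-L2d2-1 / F-L2d2-2) of abc-iut-w5-d124's `Discharge/Sec3Cor38iiiHolds.lean`: the realified base data are typed over
`treeMonoidVocabWeak` ("perf-factorial" := `IsPerfFactorialCof`, weakly perf-factorial with cofinal perfection —
the reading that holds at tempered coverings with infinitely many special-fibre components, `Ÿ`, `Z_∞`, where the
printed [FrdI] Def. 2.4 (i)(d) fails) instead of `treeMonoidVocab`.  The one input of the strong file that READ
perf-factoriality as printed — [FrdI] Thm. 4.2 (i) "`Ψ` preserves primary steps"
(`FrdI.T42.thm42i_ofFunctor_of_preservesPreSteps`) — is replaced by abc-iut-L1-t12's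
`FrdI.T42.isPrimaryPreStep_map_of_preservesPreSteps_weak` / `…_inverse_map_…` (`Thm42PrimaryStepsGeneralWeak.lean`,
over abc-iut-f-038's `Thm42PrimaryStepsWeak.lean`: the primary-steps clause of Thm. 4.2 (i) for WEAKLY
perf-factorial `Φ_i`, general type, modulo only "`Ψ`, `Ψ⁻¹` preserve pre-steps").  Everything else is the strong
file's route with the `_weak` data lemmas of `Sec3Cor38iiiFSMWeak.lean`:

* `Cor38Hyp.isFrobeniusCompatible_of_preservesPreSteps_weak` / `…_inverse_…` — "`Ψ` is compatible with arrows of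
  Frobenius type" ([FrdI] Thm. 3.4 (iii)) from C38-L02a (`FrdI.isFrobeniusCompatible_of_preservesPreSteps`);
* `Cor38Hyp.isPrimaryPreStep_map_of_preservesPreSteps_weak` / `…_inverse_map_…` — `Ψ`, `Ψ⁻¹` carry primary
  pre-steps to primary pre-steps (the binders `hprim` / `hprim'` of abc-iut-L2-d2's `cor38_iii_of_weak` and of
  `cor38_iii_ofRlfZWeak…`), from C38-L01 (`h.StandardIsotropicNotGroupLike`) + C38-L02a (`h.PreservesPreSteps`);
  `preservesPrimarySteps_of_preservesPreSteps_weak` — row C38-L02b;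
* **`Cor38Hyp.cor38_iii_of_preservesPreSteps_weak`: abc-iut-L2-t3's typed `Cor38_iii h` HOLDS for tempered
  Frobenioids over `treeMonoidVocabWeak` modulo `hF₁`, `hF₂` ([FrdI] Thm. 5.2 (ii)), C38-L01, C38-L02a and the
  Def. 3.1 support axioms `hD1`/`hDa`/`hDn`/`hDc` on both sides** — no FSM-type hypothesis, no Thm. 4.2 binder;
* `Cor38Hyp.cor38_iii_treeCatVocab_of_preservesPreSteps_weak` — at the canonical category vocabulary `treeCatVocab`,
  where C38-L01 is a theorem (abc-iut-w5-d135 lineage, `standardIsotropicNotGroupLike_treeCatVocab_of_isNonDilatingOn`,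
  any monoid vocabulary) and `hF_i` reduce to `hBmon_i : IsMonoidOn B_i` (`isFrobenioid_treeCatVocab_of_isMonoidOn`).

No definitions; no statement of either paper is restated or strengthened (a named hypothesis on the data is
WEAKENED).  HONEST FRAMING: refereed pre-IUT material; nothing here bears on [IUTchIII] Cor. 3.12; typed ≠ proved —
here PROVED modulo the named inputs.
-/

namespace Literature.AnabelianGeometry.EtaleTheta

open CategoryTheory Opposite Literature.AlgebraicGeometry.Frobenioids

universe u₀ v₀ u v w

section TreeVocabWeak

variable {D₀ : Type u₀} [Category.{v₀} D₀] {T : RealifiedDivisorMonoids (D₀ := D₀) treeMonoidVocabWeak.{w}}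
  {D : Type u} [Category.{v} D] {VD : FrdICatStub.{u, v, w} D}
  {D₀' : Type u₀} [Category.{v₀} D₀'] {T' : RealifiedDivisorMonoids (D₀ := D₀') treeMonoidVocabWeak.{w}}
  {D' : Type u} [Category.{v} D'] {VD' : FrdICatStub.{u, v, w} D'}

namespace TemperedFrobenioid

/-- Def. 3.6 (ii) read at `treeMonoidVocabWeak`: `Φ(A)` is WEAKLY perf-factorial, objectwise on `D` (the first
component of `IsPerfFactorialCof`). [cite: MochizukiEtTh2009, Def 3.6 p.77] -/
theorem objectwise_isPerfFactorialWeak_weak (C : TemperedFrobenioid T D VD) :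
    Objectwise (fun M _ => IsPerfFactorialWeak M) C.divisorMonoid :=
  fun A => Exists.elim (C.isPerfFactorial (op A)) fun hw _ => hw

end TemperedFrobenioid

namespace Cor38Hyp

open TemperedFrobenioid

/-- **C38-L02a ⟹ "`Ψ` is compatible with arrows of Frobenius type"** ([FrdI] Thm. 3.4 (iii) from pre-step
preservation, abc-iut-L1-t11's `FrdI.isFrobeniusCompatible_of_preservesPreSteps`; quasi-isotropic type, non-dilating
`Φ_i` and a non-group-like object from Thm. 3.7 (i) and `Cor38Hyp`, weak-vocabulary data lemmas), modulo `hF₁`, `hF₂`.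
[cite: MochizukiEtTh2009, Cor 3.8 p.81] -/
theorem isFrobeniusCompatible_of_preservesPreSteps_weak
    {C₁ : TemperedFrobenioid T D VD} {C₂ : TemperedFrobenioid T' D' VD'} (h : Cor38Hyp C₁ C₂)
    (hF₁ : PreFrobenioid.IsFrobenioid C₁.toElem)
    (hF₂ : PreFrobenioid.IsFrobenioid C₂.toElem) (hps : h.PreservesPreSteps) :
    PreFrobenioid.IsFrobeniusCompatible C₁.toElem C₂.toElem h.Ψ.functor :=
  FrdI.isFrobeniusCompatible_of_preservesPreSteps hF₁ hF₂ (C₁.data_isOfQuasiIsotropicType_weak hF₁)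
    (C₂.data_isOfQuasiIsotropicType_weak hF₂) (C₁.data_isNonDilatingOn_weak h.nonDilating.1)
    (C₂.data_isNonDilatingOn_weak h.nonDilating.2) h.Ψ hps.1 hps.2 C₁.exists_not_isGroupLikeObj_weak
    C₂.exists_not_isGroupLikeObj_weak

/-- … and for `Ψ⁻¹`. [cite: MochizukiEtTh2009, Cor 3.8 p.81] -/
theorem isFrobeniusCompatible_inverse_of_preservesPreSteps_weak
    {C₁ : TemperedFrobenioid T D VD} {C₂ : TemperedFrobenioid T' D' VD'} (h : Cor38Hyp C₁ C₂)
    (hF₁ : PreFrobenioid.IsFrobenioid C₁.toElem)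
    (hF₂ : PreFrobenioid.IsFrobenioid C₂.toElem) (hps : h.PreservesPreSteps) :
    PreFrobenioid.IsFrobeniusCompatible C₂.toElem C₁.toElem h.Ψ.inverse :=
  FrdI.isFrobeniusCompatible_of_preservesPreSteps hF₂ hF₁ (C₂.data_isOfQuasiIsotropicType_weak hF₂)
    (C₁.data_isOfQuasiIsotropicType_weak hF₁) (C₂.data_isNonDilatingOn_weak h.nonDilating.2)
    (C₁.data_isNonDilatingOn_weak h.nonDilating.1) h.Ψ.symm hps.2 hps.1 C₂.exists_not_isGroupLikeObj_weak
    C₁.exists_not_isGroupLikeObj_weak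

/-- **`Ψ` carries primary pre-steps to primary pre-steps** (the input `hprim` of abc-iut-L2-d2's `cor38_iii_of_weak`),
from C38-L01 + C38-L02a, modulo `hF₁`, `hF₂`: [FrdI] Thm. 4.2 (i), primary-steps clause, for WEAKLY perf-factorial
divisor monoids at general type (abc-iut-L1-t12's `FrdI.T42.isPrimaryPreStep_map_of_preservesPreSteps_weak`), the
field `isPerfFactorial` of Def. 3.6 (ii) being read at `treeMonoidVocabWeak`. PROVED. [cite: MochizukiEtTh2009, Cor 3.8 p.82] -/
theorem isPrimaryPreStep_map_of_preservesPreSteps_weak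
    {C₁ : TemperedFrobenioid T D VD} {C₂ : TemperedFrobenioid T' D' VD'} (h : Cor38Hyp C₁ C₂)
    (hF₁ : PreFrobenioid.IsFrobenioid C₁.toElem)
    (hF₂ : PreFrobenioid.IsFrobenioid C₂.toElem) (H : h.StandardIsotropicNotGroupLike) (hps : h.PreservesPreSteps)
    ⦃X Y : C₁.category⦄ (φ : X ⟶ Y) (hφ : PreFrobenioid.IsPrimaryPreStep C₁.toElem φ) :
    PreFrobenioid.IsPrimaryPreStep C₂.toElem (h.Ψ.functor.map φ) :=
  FrdI.T42.isPrimaryPreStep_map_of_preservesPreSteps_weak h.Ψ hF₁ hF₂ C₁.objectwise_isPerfFactorialWeak_weak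
    C₂.objectwise_isPerfFactorialWeak_weak
    (fun _ _ ψ hψ => (PreFrobenioidData.ofFunctor_isPreStep C₂.toElem _).1
      (hps.1 ψ ((PreFrobenioidData.ofFunctor_isPreStep C₁.toElem ψ).2 hψ)))
    (fun _ _ ψ hψ => (PreFrobenioidData.ofFunctor_isPreStep C₁.toElem _).1
      (hps.2 ψ ((PreFrobenioidData.ofFunctor_isPreStep C₂.toElem ψ).2 hψ)))
    H φ hφ

/-- … and `Ψ⁻¹` (the input `hprim'`). PROVED. [cite: MochizukiEtTh2009, Cor 3.8 p.82] -/
theorem isPrimaryPreStep_inverse_map_of_preservesPreSteps_weak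
    {C₁ : TemperedFrobenioid T D VD} {C₂ : TemperedFrobenioid T' D' VD'} (h : Cor38Hyp C₁ C₂)
    (hF₁ : PreFrobenioid.IsFrobenioid C₁.toElem)
    (hF₂ : PreFrobenioid.IsFrobenioid C₂.toElem) (H : h.StandardIsotropicNotGroupLike) (hps : h.PreservesPreSteps)
    ⦃X Y : C₂.category⦄ (φ : X ⟶ Y) (hφ : PreFrobenioid.IsPrimaryPreStep C₂.toElem φ) :
    PreFrobenioid.IsPrimaryPreStep C₁.toElem (h.Ψ.inverse.map φ) :=
  FrdI.T42.isPrimaryPreStep_inverse_map_of_preservesPreSteps_weak h.Ψ hF₁ hF₂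
    C₁.objectwise_isPerfFactorialWeak_weak C₂.objectwise_isPerfFactorialWeak_weak
    (fun _ _ ψ hψ => (PreFrobenioidData.ofFunctor_isPreStep C₂.toElem _).1
      (hps.1 ψ ((PreFrobenioidData.ofFunctor_isPreStep C₁.toElem ψ).2 hψ)))
    (fun _ _ ψ hψ => (PreFrobenioidData.ofFunctor_isPreStep C₁.toElem _).1
      (hps.2 ψ ((PreFrobenioidData.ofFunctor_isPreStep C₂.toElem ψ).2 hψ)))
    H φ hφ

/-- **Row C38-L02b ⟸ C38-L01 + C38-L02a** (modulo `hF_i`), over the weak vocabulary: `Ψ`, `Ψ⁻¹` carry primary steps to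
primary steps (steps by reflection of isomorphisms along the fully faithful `Ψ`, primary pre-steps as above). PROVED.
[cite: MochizukiEtTh2009, Cor 3.8 p.81] -/
theorem preservesPrimarySteps_of_preservesPreSteps_weak
    {C₁ : TemperedFrobenioid T D VD} {C₂ : TemperedFrobenioid T' D' VD'} (h : Cor38Hyp C₁ C₂)
    (hF₁ : PreFrobenioid.IsFrobenioid C₁.toElem)
    (hF₂ : PreFrobenioid.IsFrobenioid C₂.toElem) (H : h.StandardIsotropicNotGroupLike) (hps : h.PreservesPreSteps) :
    h.PreservesPrimarySteps :=
  ⟨FrdI.T42.preservesPrimarySteps_ofFunctor_of_preservesPreSteps_weak h.Ψ hF₁ hF₂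
      C₁.objectwise_isPerfFactorialWeak_weak C₂.objectwise_isPerfFactorialWeak_weak
      (fun _ _ ψ hψ => (PreFrobenioidData.ofFunctor_isPreStep C₂.toElem _).1
        (hps.1 ψ ((PreFrobenioidData.ofFunctor_isPreStep C₁.toElem ψ).2 hψ)))
      (fun _ _ ψ hψ => (PreFrobenioidData.ofFunctor_isPreStep C₁.toElem _).1
        (hps.2 ψ ((PreFrobenioidData.ofFunctor_isPreStep C₂.toElem ψ).2 hψ)))
      H,
    FrdI.T42.preservesPrimarySteps_ofFunctor_of_preservesPreSteps_weak h.Ψ.symm hF₂ hF₁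
      C₂.objectwise_isPerfFactorialWeak_weak C₁.objectwise_isPerfFactorialWeak_weak
      (fun _ _ ψ hψ => (PreFrobenioidData.ofFunctor_isPreStep C₁.toElem _).1
        (hps.2 ψ ((PreFrobenioidData.ofFunctor_isPreStep C₂.toElem ψ).2 hψ)))
      (fun _ _ ψ hψ => (PreFrobenioidData.ofFunctor_isPreStep C₂.toElem _).1
        (hps.1 ψ ((PreFrobenioidData.ofFunctor_isPreStep C₁.toElem ψ).2 hψ)))
      (h.standardIsotropicNotGroupLike_symm H)⟩

/-- **[EtTh] Cor. 3.8 (iii), first clause, AS TYPED (abc-iut-L2-t3's `Cor38_iii`) HOLDS over the WEAK monoid vocabulary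
modulo `hF₁`, `hF₂` ([FrdI] Thm. 5.2 (ii)), C38-L01 (Thm. 3.7 (i)(ii)), C38-L02a ([FrdI] Thm. 3.4 (ii)) and abc-iut-L2-d2's
Def. 3.1 support axioms on both sides** — primary pre-steps via [FrdI] Thm. 4.2 (i) for weakly perf-factorial `Φ_i`,
Frobenius type via Thm. 3.4 (iii), both theorems from pre-step preservation; no FSM-type hypothesis, no Thm. 4.2 binder.
PROVED. [cite: MochizukiEtTh2009, Cor 3.8 p.81] -/
theorem cor38_iii_of_preservesPreSteps_weak
    {C₁ : TemperedFrobenioid T D VD} {C₂ : TemperedFrobenioid T' D' VD'} (h : Cor38Hyp C₁ C₂)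
    (hF₁ : PreFrobenioid.IsFrobenioid C₁.toElem)
    (hF₂ : PreFrobenioid.IsFrobenioid C₂.toElem) (H : h.StandardIsotropicNotGroupLike) (hps : h.PreservesPreSteps)
    (hD1₁ : ∀ (A : Dᵒᵖ) (y : C₁.Φ.carrier A), C₁.IsBaseFieldTheoreticDiv y → C₁.IsNonCuspidal y)
    (hDa₁ : ∀ (A : Dᵒᵖ) (x : C₁.Φ.carrier A), C₁.IsNonCuspidal x → C₁.IsCuspidal x → x = 1)
    (hDn₁ : ∀ (A : Dᵒᵖ) (x : C₁.Φ.carrier A),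
      C₁.IsNonCuspidal x ↔ ∀ y : C₁.Φ.carrier A, IsPrimary y → Precsim y x → C₁.IsNonCuspidal y)
    (hDc₁ : ∀ (A : Dᵒᵖ) (x : C₁.Φ.carrier A),
      C₁.IsCuspidal x ↔ ∀ y : C₁.Φ.carrier A, IsPrimary y → Precsim y x → C₁.IsCuspidal y)
    (hD1₂ : ∀ (A : D'ᵒᵖ) (y : C₂.Φ.carrier A), C₂.IsBaseFieldTheoreticDiv y → C₂.IsNonCuspidal y)
    (hDa₂ : ∀ (A : D'ᵒᵖ) (x : C₂.Φ.carrier A), C₂.IsNonCuspidal x → C₂.IsCuspidal x → x = 1)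
    (hDn₂ : ∀ (A : D'ᵒᵖ) (x : C₂.Φ.carrier A),
      C₂.IsNonCuspidal x ↔ ∀ y : C₂.Φ.carrier A, IsPrimary y → Precsim y x → C₂.IsNonCuspidal y)
    (hDc₂ : ∀ (A : D'ᵒᵖ) (x : C₂.Φ.carrier A),
      C₂.IsCuspidal x ↔ ∀ y : C₂.Φ.carrier A, IsPrimary y → Precsim y x → C₂.IsCuspidal y) :
    Literature.AnabelianGeometry.EtaleTheta.Cor38_iii h :=
  cor38_iii_of_weak h
    (fun _ _ φ hφ => (PreFrobenioidData.ofFunctor_isPreStep C₂.toElem _).1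
      (hps.1 φ ((PreFrobenioidData.ofFunctor_isPreStep C₁.toElem φ).2 hφ)))
    (fun _ _ φ hφ => (PreFrobenioidData.ofFunctor_isPreStep C₁.toElem _).1
      (hps.2 φ ((PreFrobenioidData.ofFunctor_isPreStep C₂.toElem φ).2 hφ)))
    (h.isPrimaryPreStep_map_of_preservesPreSteps_weak hF₁ hF₂ H hps)
    (h.isPrimaryPreStep_inverse_map_of_preservesPreSteps_weak hF₁ hF₂ H hps)
    (fun _ _ φ hφ => (h.isFrobeniusCompatible_of_preservesPreSteps_weak hF₁ hF₂ hps).isFrobeniusType_map φ hφ)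
    (fun _ _ φ hφ =>
      (h.isFrobeniusCompatible_inverse_of_preservesPreSteps_weak hF₁ hF₂ hps).isFrobeniusType_map φ hφ)
    hD1₁ hDa₁ hDn₁ hDc₁ hD1₂ hDa₂ hDn₂ hDc₂

end Cor38Hyp

end TreeVocabWeak

/-! ### At the canonical category vocabulary `treeCatVocab` (weak monoid vocabulary) -/

section TreeCatVocabWeak

variable {D₀ : Type u₀} [Category.{v₀} D₀] {T : RealifiedDivisorMonoids (D₀ := D₀) treeMonoidVocabWeak.{w}}
  {D : Type u} [Category.{v} D] {IsRational IsStrictlyRational : (Dᵒᵖ ⥤ CommMonCat.{w}) → Prop}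
  {D₀' : Type u₀} [Category.{v₀} D₀'] {T' : RealifiedDivisorMonoids (D₀ := D₀') treeMonoidVocabWeak.{w}}
  {D' : Type u} [Category.{v} D'] {IsRational' IsStrictlyRational' : (D'ᵒᵖ ⥤ CommMonCat.{w}) → Prop}

/-- **C38-L01 at the canonical category vocabulary over the WEAK monoid vocabulary, with NO residual** (Thm. 3.7
(i)(ii): abc-iut-w5-d135 lineage's `standardIsotropicNotGroupLike_treeCatVocab_of_isNonDilatingOn` — any monoid
vocabulary — fed with the weak unfolding of `h.nonDilating`, `TemperedFrobenioid.isNonDilatingOn_iff_pull_weak`).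
[cite: MochizukiEtTh2009, Cor 3.8 p.81] -/
theorem Cor38Hyp.standardIsotropicNotGroupLike_treeCatVocab_weak
    {C₁ : TemperedFrobenioid T D (treeCatVocab D IsRational IsStrictlyRational)}
    {C₂ : TemperedFrobenioid T' D' (treeCatVocab D' IsRational' IsStrictlyRational')} (h : Cor38Hyp C₁ C₂) :
    h.StandardIsotropicNotGroupLike :=
  h.standardIsotropicNotGroupLike_treeCatVocab_of_isNonDilatingOn
    ((C₁.isNonDilatingOn_iff_pull_weak).2 h.nonDilating.1) ((C₂.isNonDilatingOn_iff_pull_weak).2 h.nonDilating.2)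

/-- **[EtTh] Cor. 3.8 (iii), first clause, AS TYPED at the canonical category vocabulary over the WEAK monoid
vocabulary, modulo `hBmon_i : IsMonoidOn B_i` ("`𝔹` a monoid on `D`"; then `C_i → F_{Φ_i}` IS a Frobenioid, [FrdI]
Thm. 5.2 (ii), `isFrobenioid_treeCatVocab_of_isMonoidOn`), C38-L02a and abc-iut-L2-d2's Def. 3.1 support axioms only**
(C38-L01 is a theorem here). PROVED. [cite: MochizukiEtTh2009, Cor 3.8 p.81] -/
theorem Cor38Hyp.cor38_iii_treeCatVocab_of_preservesPreSteps_weak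
    {C₁ : TemperedFrobenioid T D (treeCatVocab D IsRational IsStrictlyRational)}
    {C₂ : TemperedFrobenioid T' D' (treeCatVocab D' IsRational' IsStrictlyRational')} (h : Cor38Hyp C₁ C₂) (hBmon₁ : IsMonoidOn C₁.ratFnFunctor)
    (hBmon₂ : IsMonoidOn C₂.ratFnFunctor) (hps : h.PreservesPreSteps)
    (hD1₁ : ∀ (A : Dᵒᵖ) (y : C₁.Φ.carrier A), C₁.IsBaseFieldTheoreticDiv y → C₁.IsNonCuspidal y)
    (hDa₁ : ∀ (A : Dᵒᵖ) (x : C₁.Φ.carrier A), C₁.IsNonCuspidal x → C₁.IsCuspidal x → x = 1)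
    (hDn₁ : ∀ (A : Dᵒᵖ) (x : C₁.Φ.carrier A),
      C₁.IsNonCuspidal x ↔ ∀ y : C₁.Φ.carrier A, IsPrimary y → Precsim y x → C₁.IsNonCuspidal y)
    (hDc₁ : ∀ (A : Dᵒᵖ) (x : C₁.Φ.carrier A),
      C₁.IsCuspidal x ↔ ∀ y : C₁.Φ.carrier A, IsPrimary y → Precsim y x → C₁.IsCuspidal y)
    (hD1₂ : ∀ (A : D'ᵒᵖ) (y : C₂.Φ.carrier A), C₂.IsBaseFieldTheoreticDiv y → C₂.IsNonCuspidal y)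
    (hDa₂ : ∀ (A : D'ᵒᵖ) (x : C₂.Φ.carrier A), C₂.IsNonCuspidal x → C₂.IsCuspidal x → x = 1)
    (hDn₂ : ∀ (A : D'ᵒᵖ) (x : C₂.Φ.carrier A),
      C₂.IsNonCuspidal x ↔ ∀ y : C₂.Φ.carrier A, IsPrimary y → Precsim y x → C₂.IsNonCuspidal y)
    (hDc₂ : ∀ (A : D'ᵒᵖ) (x : C₂.Φ.carrier A),
      C₂.IsCuspidal x ↔ ∀ y : C₂.Φ.carrier A, IsPrimary y → Precsim y x → C₂.IsCuspidal y) :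
    Literature.AnabelianGeometry.EtaleTheta.Cor38_iii h :=
  h.cor38_iii_of_preservesPreSteps_weak (C₁.isFrobenioid_treeCatVocab_of_isMonoidOn hBmon₁)
    (C₂.isFrobenioid_treeCatVocab_of_isMonoidOn hBmon₂) h.standardIsotropicNotGroupLike_treeCatVocab_weak hps
    hD1₁ hDa₁ hDn₁ hDc₁ hD1₂ hDa₂ hDn₂ hDc₂

end TreeCatVocabWeak

end Literature.AnabelianGeometry.EtaleTheta
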